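/-
Solo informed (Langlands), s71: repair D2-cris, proof side — the `K₀`-action on `D_cris` and the
semilinearity of `φ_D` over the constructed `B_max(F)`.
-/
import Summits.Langlands.Langlands.Theorems.SoloInformedRepairD2CrisResidueDegree
import Summits.Langlands.Langlands.Theorems.SoloInformedRepairD2StRing
import HarnessLib

/-!
# Repair D2-cris, proof side: `D_cris(ρ_v)` is a `B_max^{Γ}`-module, `φ_D` is semilinear, `φ_D^f` is `K₀`-linear

Input-free proof-side rung of the D2-cris clause `CrystallineCompatibleAt` (file
`SoloInformedRepairD2Cris`, §4), which reads the characteristic polynomial of the operator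
`phiDcris ρ_v ^ f` (`f = f(v|ℓ)`, `q_v = ℓ^f`) on `D = D_cris(ρ|Γ_{K_v})` over the CONSTRUCTED
`B_max(F) = A_max[1/t]`.  Fontaine's recipe `WD(D_cris)(Frob_geom) := φ^f|_{D_τ}` presumes that `D` is a
`K₀ ⊗_{ℚ_p} ℚ̄_p`-module (`K₀ = F₀ = W(k_F)[1/p]`) on which `φ` is semilinear and `φ^f` is LINEAR; this
file proves exactly that for the constructed objects, for EVERY framed `ρ_v` (no finiteness, no
admissibility):

* §1 (abstract `ℚ_p`-algebra `B`, family `Γ` of automorphisms, `φ` commuting with `Γ`): the invariant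
  periods form a `ℚ_p`-subalgebra `fixedSubalgebra gal = B^Γ`, stable under `φ` (`phiFix`);
  `D(ρ) = (E^m ⊗_{ℚ_p} B)^Γ` is a `B^Γ`-module — `mulD ρ gal : B^Γ →+* End_E D(ρ)`, `b ↦ (1 ⊗ (b·))|_D`
  (tree `D2St.endD`); **semilinearity** `φ_D ∘ M_b = M_{φ b} ∘ φ_D` and `φ_D^k ∘ M_b = M_{φ^k b} ∘ φ_D^k`;
  `φ_D` carries an `M_b`-eigenvector of eigenvalue `c` to an `M_{φ b}`-eigenvector of eigenvalue `c`.
* §2 (`B = B_max(F)`, `Γ = Γ_F`): the Teichmüller periods `u_a = [ā]` (`teichBmax`, file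
  `SoloInformedRepairD2CrisTeichmuller`) give a monoid homomorphism `teichPeriod : 𝒪_F →* B_max(F)^{Γ_F}`
  with `u_a^{q_F} = u_a` and `u_a^{q_F-1} = 1` for `a ∈ 𝒪_F^×`, `φ u_a = u_a^p`; composing,
  **`mulDcris ρ_v : 𝒪_F →* End D_cris(ρ_v)`** (`a ↦ M_a`), with `M_a^{q_F} = M_a`, `M_a^{q_F-1} = 1`
  (`a` a unit), `φ_D ∘ M_a = M_a^p ∘ φ_D`, `φ_D^k ∘ M_a = M_a^{p^k} ∘ φ_D^k`, and the headline
  **`φ_D^f ∘ M_a = M_a ∘ φ_D^f` when `q_F = p^f`**: the clause's operator `phiDcris ρ_v ^ f` is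
  `K₀`-linear.  Consequences: an eigenvalue `c ∈ ℚ̄_p` of `M_a` satisfies `c^{q_F} = c` (and
  `c^{q_F-1} = 1` for `a` a unit) — the eigenspaces `D_c` are indexed by Teichmüller-type roots of unity,
  i.e. by the `τ : K₀ → ℚ̄_p` — and `φ_D^f` preserves every `D_c`, while `φ_D` moves `D_c` into the
  `c`-eigenspace of `M_a^p`.

Not here: that only PRIMITIVE `(q_F-1)`-th roots of unity occur (equivalently `charpoly (φ_D^f) = P^f`,
the shape the clause quantifies) and the exact rank — both need more of `K₀ ⊆ B_max^{Γ_F}` than the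
periods `u_a` (the minimal polynomial of `u_a` over `ℚ_p`, resp. `B_max^{Γ_F} = F₀`).

## References
* [FontaineAsterisque223III] J.-M. Fontaine, *Le corps des périodes `p`-adiques*, Astérisque 223 (1994),
  Exp. II §2.3 (`W(k̄) ⊆ A_inf`, `φ[x] = [x^p]`), Exp. III §1.3–1.5 (`D_B(V)` as a `B^G`-module).
* [FontaineAsterisque223VIII] J.-M. Fontaine, *Représentations `ℓ`-adiques potentiellement semi-stables*,
  Astérisque 223 (1994), Exp. VIII §2.3.7 (`φ^f` is `K₀`-linear; `WD(D)`).
* [BuzzardGeeLMS2014] K. Buzzard, T. Gee, *The conjectural connections between automorphic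
  representations and Galois representations* (2014), Conj. 3.2.2.
* [Colmez1998Annals] P. Colmez, *Théorie d'Iwasawa des représentations de de Rham d'un corps local*,
  Ann. of Math. 148 (1998), §III.2 (`B_max`).
-/

noncomputable section

open scoped MatrixGroups TensorProduct ValuativeRel
open Field WittVector ValuativeRel
open Literature.NumberTheory.GaloisRepresentations Literature.NumberTheory.PAdicHodge
open Literature.NumberTheory.GaloisRepresentations.IsNonarchimedeanLocalField

namespace Summit.Langlands.Langlands.Theorems

namespace D2Cris

open D2St

/-! ### §1 `B^Γ`, the `B^Γ`-module structure of `D(ρ) = (E^m ⊗_{ℚ_p} B)^Γ`, semilinearity of `φ_D` -/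

section Abstract

variable {p : ℕ} [Fact p.Prime] {E : Type*} [Field E] [Algebra ℚ_[p] E]
  {Γ : Type*} {B : Type*} [CommRing B] [Algebra ℚ_[p] B] {m : ℕ}

/-- **`B^Γ`**: the `ℚ_p`-subalgebra of `Γ`-invariant periods of `B` (for `B = B_max(F)`, `Γ = Γ_F` it
contains `K₀ = W(k_F)[1/p]`, §2). [cite: FontaineAsterisque223III, Exp. III §1.3] -/
def fixedSubalgebra (gal : Γ → (B →ₐ[ℚ_[p]] B)) : Subalgebra ℚ_[p] B where
  carrier := {b | ∀ σ : Γ, gal σ b = b}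
  mul_mem' {a b} ha hb σ := by rw [map_mul, ha σ, hb σ]
  one_mem' σ := map_one _
  add_mem' {a b} ha hb σ := by rw [map_add, ha σ, hb σ]
  zero_mem' σ := map_zero _
  algebraMap_mem' c σ := AlgHom.commutes _ c

/-- Membership in `B^Γ`. [folklore] -/
@[simp] theorem mem_fixedSubalgebra_iff {gal : Γ → (B →ₐ[ℚ_[p]] B)} {b : B} :
    b ∈ fixedSubalgebra gal ↔ ∀ σ : Γ, gal σ b = b := Iff.rfl

/-- An element of `B^Γ` is fixed. [folklore] -/
theorem gal_coe_fixedSubalgebra {gal : Γ → (B →ₐ[ℚ_[p]] B)} (b : fixedSubalgebra gal) (σ : Γ) :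
    gal σ (b : B) = b := b.2 σ

/-- **`φ` preserves `B^Γ`** when it commutes with `Γ`: `φ_fix : B^Γ → B^Γ`. [cite: FontaineAsterisque223III, Exp. II §2.3] -/
def phiFix (gal : Γ → (B →ₐ[ℚ_[p]] B)) (φ : B →ₐ[ℚ_[p]] B) (hφ : ∀ σ, (gal σ).comp φ = φ.comp (gal σ))
    (b : fixedSubalgebra gal) : fixedSubalgebra gal :=
  ⟨φ b, fun σ => by rw [← AlgHom.comp_apply, hφ, AlgHom.comp_apply, gal_coe_fixedSubalgebra]⟩

/-- `(φ_fix b : B) = φ b`. [folklore] -/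
@[simp] theorem coe_phiFix (gal : Γ → (B →ₐ[ℚ_[p]] B)) (φ : B →ₐ[ℚ_[p]] B)
    (hφ : ∀ σ, (gal σ).comp φ = φ.comp (gal σ)) (b : fixedSubalgebra gal) :
    ((phiFix gal φ hφ b : fixedSubalgebra gal) : B) = φ b := rfl

/-- `(φ_fix^[k] b : B) = φ^[k] b`. [folklore] -/
theorem coe_phiFix_iterate (gal : Γ → (B →ₐ[ℚ_[p]] B)) (φ : B →ₐ[ℚ_[p]] B)
    (hφ : ∀ σ, (gal σ).comp φ = φ.comp (gal σ)) (k : ℕ) (b : fixedSubalgebra gal) :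
    (((phiFix gal φ hφ)^[k] b : fixedSubalgebra gal) : B) = (φ : B → B)^[k] b := by
  induction k with
  | zero => rfl
  | succ k ih => rw [Function.iterate_succ_apply', Function.iterate_succ_apply', coe_phiFix, ih]

/-- A `Γ`-invariant `b` commutes with the action: `σ ∘ (b·) = (b·) ∘ σ` on `B`. [folklore] -/
theorem gal_comp_mulLeft (gal : Γ → (B →ₐ[ℚ_[p]] B)) (b : fixedSubalgebra gal) (σ : Γ) :
    (gal σ).toLinearMap ∘ₗ LinearMap.mulLeft ℚ_[p] (b : B) =
      LinearMap.mulLeft ℚ_[p] (b : B) ∘ₗ (gal σ).toLinearMap := by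
  ext y
  simp only [LinearMap.comp_apply, LinearMap.mulLeft_apply, AlgHom.toLinearMap_apply, map_mul,
    gal_coe_fixedSubalgebra]

/-- `(1 ⊗ (b·))` on a pure tensor. [folklore] -/
theorem endTensor_mulLeft_tmul (b : B) (v : Fin m → E) (y : B) :
    endTensor (E := E) (LinearMap.mulLeft ℚ_[p] b) (v ⊗ₜ[ℚ_[p]] y) = v ⊗ₜ[ℚ_[p]] (b * y) := by
  simp only [endTensor, TensorProduct.AlgebraTensorModule.map_tmul, LinearMap.id_apply,
    LinearMap.mulLeft_apply]

/-- `1 ⊗ (1·) = id`. [folklore] -/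
theorem endTensor_mulLeft_one :
    endTensor (E := E) (m := m) (LinearMap.mulLeft ℚ_[p] (1 : B)) = LinearMap.id :=
  TensorProduct.AlgebraTensorModule.ext fun v y => by
    rw [endTensor_mulLeft_tmul, one_mul, LinearMap.id_apply]

/-- `1 ⊗ (0·) = 0`. [folklore] -/
theorem endTensor_mulLeft_zero :
    endTensor (E := E) (m := m) (LinearMap.mulLeft ℚ_[p] (0 : B)) = 0 :=
  TensorProduct.AlgebraTensorModule.ext fun v y => by
    rw [endTensor_mulLeft_tmul, zero_mul, TensorProduct.tmul_zero, LinearMap.zero_apply]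

/-- `1 ⊗ ((b₁ b₂)·) = (1 ⊗ (b₁·)) ∘ (1 ⊗ (b₂·))`. [folklore] -/
theorem endTensor_mulLeft_mul (b₁ b₂ : B) :
    endTensor (E := E) (m := m) (LinearMap.mulLeft ℚ_[p] (b₁ * b₂)) =
      endTensor (LinearMap.mulLeft ℚ_[p] b₁) ∘ₗ endTensor (LinearMap.mulLeft ℚ_[p] b₂) :=
  TensorProduct.AlgebraTensorModule.ext fun v y => by
    rw [LinearMap.comp_apply, endTensor_mulLeft_tmul, endTensor_mulLeft_tmul, endTensor_mulLeft_tmul,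
      mul_assoc]

/-- `1 ⊗ ((b₁ + b₂)·) = (1 ⊗ (b₁·)) + (1 ⊗ (b₂·))`. [folklore] -/
theorem endTensor_mulLeft_add (b₁ b₂ : B) :
    endTensor (E := E) (m := m) (LinearMap.mulLeft ℚ_[p] (b₁ + b₂)) =
      endTensor (LinearMap.mulLeft ℚ_[p] b₁) + endTensor (LinearMap.mulLeft ℚ_[p] b₂) :=
  TensorProduct.AlgebraTensorModule.ext fun v y => by
    rw [LinearMap.add_apply, endTensor_mulLeft_tmul, endTensor_mulLeft_tmul, endTensor_mulLeft_tmul,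
      add_mul, TensorProduct.tmul_add]

/-- **`D(ρ)` is a `B^Γ`-module**: `b ↦ M_b := (1 ⊗ (b·))|_{D(ρ)}`, a ring homomorphism
`B^Γ → End_E D(ρ)` (each `M_b` is the tree's `D2St.endD` of `(b·)`). [cite: FontaineAsterisque223III, Exp. III §1.3] -/
def mulD (ρ : Γ → GL (Fin m) E) (gal : Γ → (B →ₐ[ℚ_[p]] B)) :
    fixedSubalgebra gal →+* Module.End E (invariants ρ gal) where
  toFun b := endD ρ gal (LinearMap.mulLeft ℚ_[p] (b : B)) (gal_comp_mulLeft gal b)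
  map_one' := LinearMap.ext fun x => Subtype.ext <|
    LinearMap.congr_fun (endTensor_mulLeft_one (E := E) (m := m) (B := B) (p := p)) (x : (Fin m → E) ⊗[ℚ_[p]] B)
  map_mul' b₁ b₂ := LinearMap.ext fun x => Subtype.ext <|
    LinearMap.congr_fun (endTensor_mulLeft_mul (E := E) (m := m) (b₁ : B) (b₂ : B)) (x : (Fin m → E) ⊗[ℚ_[p]] B)
  map_zero' := LinearMap.ext fun x => Subtype.ext <|
    LinearMap.congr_fun (endTensor_mulLeft_zero (E := E) (m := m) (B := B) (p := p)) (x : (Fin m → E) ⊗[ℚ_[p]] B)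
  map_add' b₁ b₂ := LinearMap.ext fun x => Subtype.ext <|
    LinearMap.congr_fun (endTensor_mulLeft_add (E := E) (m := m) (b₁ : B) (b₂ : B)) (x : (Fin m → E) ⊗[ℚ_[p]] B)

/-- Underlying tensor of `M_b x`. [folklore] -/
theorem coe_mulD (ρ : Γ → GL (Fin m) E) (gal : Γ → (B →ₐ[ℚ_[p]] B)) (b : fixedSubalgebra gal)
    (x : invariants ρ gal) :
    ((mulD ρ gal b x : invariants ρ gal) : (Fin m → E) ⊗[ℚ_[p]] B) =
      endTensor (LinearMap.mulLeft ℚ_[p] (b : B)) (x : (Fin m → E) ⊗[ℚ_[p]] B) := rfl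

/-- Underlying tensor of `φ_D x`. [folklore] -/
theorem coe_phiD (ρ : Γ → GL (Fin m) E) (gal : Γ → (B →ₐ[ℚ_[p]] B)) (φ : B →ₐ[ℚ_[p]] B)
    (hφ : ∀ σ, (gal σ).comp φ = φ.comp (gal σ)) (x : invariants ρ gal) :
    ((phiD ρ gal φ hφ x : invariants ρ gal) : (Fin m → E) ⊗[ℚ_[p]] B) =
      phiTensor φ (x : (Fin m → E) ⊗[ℚ_[p]] B) := rfl

/-- `(1 ⊗ φ) ∘ (1 ⊗ (b·)) = (1 ⊗ (φ b ·)) ∘ (1 ⊗ φ)` on `E^m ⊗_{ℚ_p} B`. [folklore] -/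
theorem phiTensor_comp_endTensor_mulLeft (φ : B →ₐ[ℚ_[p]] B) (b : B) :
    phiTensor (E := E) (m := m) φ ∘ₗ endTensor (LinearMap.mulLeft ℚ_[p] b) =
      endTensor (LinearMap.mulLeft ℚ_[p] (φ b)) ∘ₗ phiTensor φ :=
  TensorProduct.AlgebraTensorModule.ext fun v y => by
    simp only [LinearMap.comp_apply, endTensor_mulLeft_tmul, phiTensor,
      TensorProduct.AlgebraTensorModule.map_tmul, LinearMap.id_apply, AlgHom.toLinearMap_apply, map_mul]

/-- **`φ_D` is `B^Γ`-semilinear**: `φ_D ∘ M_b = M_{φ b} ∘ φ_D`. [cite: FontaineAsterisque223III, Exp. III §1.3] -/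
theorem phiD_comp_mulD (ρ : Γ → GL (Fin m) E) (gal : Γ → (B →ₐ[ℚ_[p]] B)) (φ : B →ₐ[ℚ_[p]] B)
    (hφ : ∀ σ, (gal σ).comp φ = φ.comp (gal σ)) (b : fixedSubalgebra gal) :
    phiD ρ gal φ hφ ∘ₗ mulD ρ gal b = mulD ρ gal (phiFix gal φ hφ b) ∘ₗ phiD ρ gal φ hφ :=
  LinearMap.ext fun x => Subtype.ext <|
    LinearMap.congr_fun (phiTensor_comp_endTensor_mulLeft (E := E) (m := m) φ (b : B))
      (x : (Fin m → E) ⊗[ℚ_[p]] B)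

/-- **`φ_D^k ∘ M_b = M_{φ^k b} ∘ φ_D^k`.** [cite: FontaineAsterisque223III, Exp. III §1.3] -/
theorem phiD_pow_comp_mulD (ρ : Γ → GL (Fin m) E) (gal : Γ → (B →ₐ[ℚ_[p]] B)) (φ : B →ₐ[ℚ_[p]] B)
    (hφ : ∀ σ, (gal σ).comp φ = φ.comp (gal σ)) (k : ℕ) (b : fixedSubalgebra gal) :
    (phiD ρ gal φ hφ ^ k) ∘ₗ mulD ρ gal b =
      mulD ρ gal ((phiFix gal φ hφ)^[k] b) ∘ₗ (phiD ρ gal φ hφ ^ k) := by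
  induction k with
  | zero =>
    rw [pow_zero, Function.iterate_zero_apply, Module.End.one_eq_id, LinearMap.id_comp, LinearMap.comp_id]
  | succ k ih =>
    rw [pow_succ', Module.End.mul_eq_comp, LinearMap.comp_assoc, ih, ← LinearMap.comp_assoc,
      phiD_comp_mulD, LinearMap.comp_assoc, Function.iterate_succ_apply']

/-- `φ_D` carries an `M_b`-eigenvector of eigenvalue `c` to an `M_{φ b}`-eigenvector of eigenvalue `c`. [folklore] -/
theorem mulD_phiFix_phiD_of_eq_smul (ρ : Γ → GL (Fin m) E) (gal : Γ → (B →ₐ[ℚ_[p]] B))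
    (φ : B →ₐ[ℚ_[p]] B) (hφ : ∀ σ, (gal σ).comp φ = φ.comp (gal σ)) (b : fixedSubalgebra gal)
    {x : invariants ρ gal} {c : E} (hx : mulD ρ gal b x = c • x) :
    mulD ρ gal (phiFix gal φ hφ b) (phiD ρ gal φ hφ x) = c • phiD ρ gal φ hφ x := by
  have h := LinearMap.congr_fun (phiD_comp_mulD ρ gal φ hφ b) x
  simp only [LinearMap.comp_apply, hx, map_smul] at h
  exact h.symm

end Abstract

/-! ### §2 `B = B_max(F)`: the Teichmüller periods act on `D_cris(ρ_v)`; `φ_D^f` is `K₀`-linear -/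

variable {F : Type} [Field F] [ValuativeRel F] [TopologicalSpace F] [IsNonarchimedeanLocalField F]
  [CharZero F] {p : ℕ} [Fact p.Prime] [Fact (¬ IsUnit (p : maxUnramifiedCompletion F))]
  [CharP (IsLocalRing.ResidueField (maxUnramifiedCompletion F)) p] [Fact (¬ IsUnit (p : integerC F))]
  [IsAdicComplete (Ideal.span {(p : integerC F)}) (integerC F)] {m : ℕ}

/-- `u_{ab} = u_a u_b`. [folklore] -/
theorem teichBmax_mul (a b : 𝒪[F]) : teichBmax (p := p) (a * b) = teichBmax a * teichBmax b := by
  simp only [← ainfToBmax_teichAinf, teichAinf, map_mul]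

/-- `u_1 = 1`. [folklore] -/
theorem teichBmax_one : teichBmax (p := p) (1 : 𝒪[F]) = 1 := by
  simp only [← ainfToBmax_teichAinf, teichAinf, map_one]

/-- **`u_a ^ (q_F - 1) = 1` for a unit `a ∈ 𝒪_F^×`** (`ā ≠ 0`, `ā^{q_F} = ā`). [cite: FontaineAsterisque223III, Exp. II §2.3] -/
theorem teichBmax_pow_residueFieldCard_sub_one {a : 𝒪[F]} (ha : a ∉ 𝓂[F]) :
    teichBmax (p := p) a ^ (residueFieldCard F - 1) = 1 := by
  rcases Nat.eq_zero_or_pos (residueFieldCard F) with h0 | hq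
  · rw [h0, Nat.zero_sub, pow_zero]
  have hx0 : resBar F a ≠ 0 := fun h => ha ((resBar_eq_zero_iff a).1 h)
  have hx : resBar F a ^ (residueFieldCard F - 1) = 1 := by
    have h := resBar_pow_residueFieldCard (F := F) a
    rw [← Nat.sub_add_cancel hq, pow_succ] at h
    exact mul_right_cancel₀ hx0 (h.trans (one_mul _).symm)
  rw [← ainfToBmax_teichAinf, teichAinf, ← map_pow, ← map_pow, ← map_pow, hx, map_one, map_one, map_one]

/-- `u_a ∈ B_max(F)^{Γ_F}`. [cite: FontaineAsterisque223III, Exp. II §2.3] -/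
theorem teichBmax_mem_fixedSubalgebra (a : 𝒪[F]) :
    teichBmax (p := p) a ∈ fixedSubalgebra (galBmaxAlgHom (F := F) (p := p)) :=
  fun σ => galBmax_teichBmax σ a

variable (F p) in
/-- **The Teichmüller character `𝒪_F →* B_max(F)^{Γ_F}`, `a ↦ u_a = [ā]`** (its values generate
`K₀ = W(k_F)[1/p] ⊆ B_max^{Γ_F}`). [cite: FontaineAsterisque223III, Exp. II §2.3] -/
def teichPeriod : 𝒪[F] →* fixedSubalgebra (galBmaxAlgHom (F := F) (p := p)) where
  toFun a := ⟨teichBmax a, teichBmax_mem_fixedSubalgebra a⟩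
  map_one' := Subtype.ext teichBmax_one
  map_mul' a b := Subtype.ext (teichBmax_mul a b)

/-- `(teichPeriod a : B_max) = u_a`. [folklore] -/
@[simp] theorem coe_teichPeriod (a : 𝒪[F]) :
    ((teichPeriod F p a : fixedSubalgebra (galBmaxAlgHom (F := F) (p := p))) : Bmax F p) = teichBmax a := rfl

/-- `(teichPeriod a)^{q_F} = teichPeriod a`. [folklore] -/
theorem teichPeriod_pow_residueFieldCard (a : 𝒪[F]) :
    teichPeriod F p a ^ residueFieldCard F = teichPeriod F p a :=
  Subtype.ext <| by rw [SubmonoidClass.coe_pow, coe_teichPeriod, teichBmax_pow_residueFieldCard]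

/-- `(teichPeriod a)^{q_F - 1} = 1` for a unit `a`. [folklore] -/
theorem teichPeriod_pow_residueFieldCard_sub_one {a : 𝒪[F]} (ha : a ∉ 𝓂[F]) :
    teichPeriod F p a ^ (residueFieldCard F - 1) = 1 :=
  Subtype.ext <| by rw [SubmonoidClass.coe_pow, coe_teichPeriod, teichBmax_pow_residueFieldCard_sub_one ha,
    OneMemClass.coe_one]

/-- **`φ_fix (teichPeriod a) = (teichPeriod a)^p`** (`φ[ā] = [ā]^p`). [cite: FontaineAsterisque223III, Exp. II §2.3] -/
theorem phiFix_teichPeriod (a : 𝒪[F]) :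
    phiFix (galBmaxAlgHom (F := F) (p := p)) (frobBmaxAlgHom F p) galBmaxAlgHom_comp_frobBmaxAlgHom
      (teichPeriod F p a) = teichPeriod F p a ^ p :=
  Subtype.ext <| by
    rw [coe_phiFix, SubmonoidClass.coe_pow, coe_teichPeriod]
    exact frobBmax_teichBmax a

/-- `φ_fix^[k] (teichPeriod a) = (teichPeriod a)^{p^k}`. [folklore] -/
theorem phiFix_iterate_teichPeriod (k : ℕ) (a : 𝒪[F]) :
    (phiFix (galBmaxAlgHom (F := F) (p := p)) (frobBmaxAlgHom F p) galBmaxAlgHom_comp_frobBmaxAlgHom)^[k]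
      (teichPeriod F p a) = teichPeriod F p a ^ p ^ k :=
  Subtype.ext <| by
    rw [coe_phiFix_iterate, SubmonoidClass.coe_pow, coe_teichPeriod]
    exact frobBmax_iterate_teichBmax k a

/-- **`M_a`: the Teichmüller period `u_a` acting on `D_cris(ρ_v)`**, as the monoid homomorphism
`𝒪_F →* End_{ℚ̄_p} D_cris(ρ_v)`, `a ↦ (1 ⊗ (u_a ·))|_{D_cris}` — the `K₀`-module structure of `D_cris`
on generators. [cite: FontaineAsterisque223III, Exp. III §1.5] -/
def mulDcris (ρv : FramedRep (absoluteGaloisGroup F) (PadicAlgCl p) m) :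
    𝒪[F] →* Module.End (PadicAlgCl p) (Dcris (F := F) (p := p) ρv) :=
  ((mulD ρv (galBmaxAlgHom (F := F) (p := p))).toMonoidHom).comp (teichPeriod F p)

/-- `M_a = mulD (teichPeriod a)`. [folklore] -/
theorem mulDcris_apply (ρv : FramedRep (absoluteGaloisGroup F) (PadicAlgCl p) m) (a : 𝒪[F]) :
    mulDcris ρv a = mulD ρv (galBmaxAlgHom (F := F) (p := p)) (teichPeriod F p a) := rfl

/-- **`M_a (v ⊗ y) = v ⊗ u_a y`** on underlying tensors. [folklore] -/
theorem coe_mulDcris (ρv : FramedRep (absoluteGaloisGroup F) (PadicAlgCl p) m) (a : 𝒪[F])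
    (x : Dcris (F := F) (p := p) ρv) :
    ((mulDcris ρv a x : Dcris ρv) : (Fin m → PadicAlgCl p) ⊗[ℚ_[p]] Bmax F p) =
      endTensor (LinearMap.mulLeft ℚ_[p] (teichBmax a)) (x : (Fin m → PadicAlgCl p) ⊗[ℚ_[p]] Bmax F p) := rfl

/-- **`M_a^{q_F} = M_a`.** [cite: FontaineAsterisque223III, Exp. II §2.3] -/
theorem mulDcris_pow_residueFieldCard (ρv : FramedRep (absoluteGaloisGroup F) (PadicAlgCl p) m) (a : 𝒪[F]) :
    mulDcris ρv a ^ residueFieldCard F = mulDcris ρv a := by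
  change mulD ρv (galBmaxAlgHom (F := F) (p := p)) (teichPeriod F p a) ^ residueFieldCard F =
    mulD ρv (galBmaxAlgHom (F := F) (p := p)) (teichPeriod F p a)
  rw [← map_pow, teichPeriod_pow_residueFieldCard]

/-- **`M_a^{q_F - 1} = 1` for a unit `a`** (`M_a` is invertible, of finite order dividing `q_F - 1`). [folklore] -/
theorem mulDcris_pow_residueFieldCard_sub_one (ρv : FramedRep (absoluteGaloisGroup F) (PadicAlgCl p) m)
    {a : 𝒪[F]} (ha : a ∉ 𝓂[F]) : mulDcris ρv a ^ (residueFieldCard F - 1) = 1 := by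
  change mulD ρv (galBmaxAlgHom (F := F) (p := p)) (teichPeriod F p a) ^ (residueFieldCard F - 1) = 1
  rw [← map_pow, teichPeriod_pow_residueFieldCard_sub_one ha, map_one]

/-- **`φ_D ∘ M_a = M_a^p ∘ φ_D`** (`φ_D` is `σ`-semilinear for the `K₀`-structure). [cite: FontaineAsterisque223III, Exp. III §1.3] -/
theorem phiDcris_comp_mulDcris (ρv : FramedRep (absoluteGaloisGroup F) (PadicAlgCl p) m) (a : 𝒪[F]) :
    phiDcris ρv ∘ₗ mulDcris ρv a = (mulDcris ρv a ^ p) ∘ₗ phiDcris ρv := by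
  change phiD ρv _ _ _ ∘ₗ mulD ρv (galBmaxAlgHom (F := F) (p := p)) (teichPeriod F p a) =
    (mulD ρv (galBmaxAlgHom (F := F) (p := p)) (teichPeriod F p a) ^ p) ∘ₗ phiD ρv _ _ _
  rw [← map_pow, ← phiFix_teichPeriod]
  exact phiD_comp_mulD ρv _ _ _ _

/-- **`φ_D^k ∘ M_a = M_a^{p^k} ∘ φ_D^k`.** [cite: FontaineAsterisque223III, Exp. III §1.3] -/
theorem phiDcris_pow_comp_mulDcris (ρv : FramedRep (absoluteGaloisGroup F) (PadicAlgCl p) m) (k : ℕ) (a : 𝒪[F]) :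
    (phiDcris ρv ^ k) ∘ₗ mulDcris ρv a = (mulDcris ρv a ^ p ^ k) ∘ₗ (phiDcris ρv ^ k) := by
  change (phiD ρv _ _ _ ^ k) ∘ₗ mulD ρv (galBmaxAlgHom (F := F) (p := p)) (teichPeriod F p a) =
    (mulD ρv (galBmaxAlgHom (F := F) (p := p)) (teichPeriod F p a) ^ p ^ k) ∘ₗ (phiD ρv _ _ _ ^ k)
  rw [← map_pow, ← phiFix_iterate_teichPeriod]
  exact phiD_pow_comp_mulD ρv _ _ _ k _

/-- **`φ_D^f ∘ M_a = M_a ∘ φ_D^f` when `q_F = p^f`: the clause's operator `phiDcris ρ_v ^ f` is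
`K₀`-linear.** [cite: FontaineAsterisque223VIII, §2.3.7] [cite: BuzzardGeeLMS2014, Conj. 3.2.2] -/
theorem phiDcris_pow_comp_mulDcris_of_card (ρv : FramedRep (absoluteGaloisGroup F) (PadicAlgCl p) m)
    {f : ℕ} (hq : residueFieldCard F = p ^ f) (a : 𝒪[F]) :
    (phiDcris ρv ^ f) ∘ₗ mulDcris ρv a = mulDcris ρv a ∘ₗ (phiDcris ρv ^ f) := by
  rw [phiDcris_pow_comp_mulDcris, ← hq, mulDcris_pow_residueFieldCard]

/-- Pointwise form: `M_a (φ_D^f x) = φ_D^f (M_a x)`. [folklore] -/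
theorem mulDcris_phiDcris_pow_apply (ρv : FramedRep (absoluteGaloisGroup F) (PadicAlgCl p) m)
    {f : ℕ} (hq : residueFieldCard F = p ^ f) (a : 𝒪[F]) (x : Dcris (F := F) (p := p) ρv) :
    mulDcris ρv a ((phiDcris ρv ^ f) x) = (phiDcris ρv ^ f) (mulDcris ρv a x) := by
  have h := LinearMap.congr_fun (phiDcris_pow_comp_mulDcris_of_card ρv hq a) x
  simp only [LinearMap.comp_apply] at h
  exact h.symm

/-- **`φ_D^f` preserves every `M_a`-eigenspace `D_c`** (the `τ`-components of `D_cris` as a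
`K₀ ⊗ ℚ̄_p`-module are `φ^f`-stable). [cite: FontaineAsterisque223VIII, §2.3.7] -/
theorem mulDcris_phiDcris_pow_of_eq_smul (ρv : FramedRep (absoluteGaloisGroup F) (PadicAlgCl p) m)
    {f : ℕ} (hq : residueFieldCard F = p ^ f) (a : 𝒪[F]) {x : Dcris (F := F) (p := p) ρv} {c : PadicAlgCl p}
    (hx : mulDcris ρv a x = c • x) : mulDcris ρv a ((phiDcris ρv ^ f) x) = c • (phiDcris ρv ^ f) x := by
  rw [mulDcris_phiDcris_pow_apply ρv hq, hx, map_smul]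

/-- **`φ_D` moves `D_c` into the `c`-eigenspace of `M_a^p`** (`φ : D_τ → D_{τ ∘ φ⁻¹}`). [cite: FontaineAsterisque223III, Exp. III §1.3] -/
theorem mulDcris_pow_phiDcris_of_eq_smul (ρv : FramedRep (absoluteGaloisGroup F) (PadicAlgCl p) m) (a : 𝒪[F])
    {x : Dcris (F := F) (p := p) ρv} {c : PadicAlgCl p} (hx : mulDcris ρv a x = c • x) :
    (mulDcris ρv a ^ p) (phiDcris ρv x) = c • phiDcris ρv x := by
  have h := LinearMap.congr_fun (phiDcris_comp_mulDcris ρv a) x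
  simp only [LinearMap.comp_apply, hx, map_smul] at h
  exact h.symm

/-- `M_a^k x = c^k • x` for an `M_a`-eigenvector `x`. [folklore] -/
theorem mulDcris_pow_apply_of_eq_smul (ρv : FramedRep (absoluteGaloisGroup F) (PadicAlgCl p) m) (a : 𝒪[F])
    {x : Dcris (F := F) (p := p) ρv} {c : PadicAlgCl p} (hx : mulDcris ρv a x = c • x) (k : ℕ) :
    (mulDcris ρv a ^ k) x = c ^ k • x := by
  induction k with
  | zero => rw [pow_zero, pow_zero, Module.End.one_apply, one_smul]
  | succ k ih => rw [pow_succ, Module.End.mul_apply, hx, map_smul, ih, smul_smul, pow_succ']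

/-- **Eigenvalues of `M_a` satisfy `c^{q_F} = c`**: they are `0` or `(q_F - 1)`-th roots of unity of
`ℚ̄_p` — Teichmüller-type, indexed by the embeddings `τ : K₀ → ℚ̄_p`. [cite: FontaineAsterisque223VIII, §2.3.7] -/
theorem pow_residueFieldCard_eq_of_mulDcris_eq_smul (ρv : FramedRep (absoluteGaloisGroup F) (PadicAlgCl p) m)
    (a : 𝒪[F]) {x : Dcris (F := F) (p := p) ρv} {c : PadicAlgCl p} (hx : mulDcris ρv a x = c • x)
    (hx0 : x ≠ 0) : c ^ residueFieldCard F = c := by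
  have h := mulDcris_pow_apply_of_eq_smul ρv a hx (residueFieldCard F)
  rw [mulDcris_pow_residueFieldCard, hx] at h
  exact ((smul_left_inj (R := PadicAlgCl p) (M := Dcris (F := F) (p := p) ρv) hx0).1 h).symm

/-- For a unit `a`, the eigenvalues of `M_a` are `(q_F - 1)`-th roots of unity: `c^{q_F - 1} = 1`. [folklore] -/
theorem pow_residueFieldCard_sub_one_eq_one_of_mulDcris_eq_smul
    (ρv : FramedRep (absoluteGaloisGroup F) (PadicAlgCl p) m) {a : 𝒪[F]} (ha : a ∉ 𝓂[F])
    {x : Dcris (F := F) (p := p) ρv} {c : PadicAlgCl p} (hx : mulDcris ρv a x = c • x) (hx0 : x ≠ 0) :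
    c ^ (residueFieldCard F - 1) = 1 := by
  have h := mulDcris_pow_apply_of_eq_smul ρv a hx (residueFieldCard F - 1)
  rw [mulDcris_pow_residueFieldCard_sub_one ρv ha, Module.End.one_apply] at h
  exact ((smul_left_inj (R := PadicAlgCl p) (M := Dcris (F := F) (p := p) ρv) hx0).1
    ((one_smul (PadicAlgCl p) x).trans h)).symm

end D2Cris

end Summit.Langlands.Langlands.Theorems

end
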